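import Mathlib
import Summits.ValiantsHypothesis.ValiantsHypothesis.Theorems.LiouvilleSarnakLiouvilleCutRankSignPatternsTools
import Summits.ValiantsHypothesis.ValiantsHypothesis.Theorems.LiouvilleSarnakLiouvilleCutRankPeriodicRatio
import HarnessLib

/-!
# Route LiouvilleSarnak — crux `LiouvilleCutRank` (stmt-ValiantsHypothesis-14775):
# digit bookkeeping for ARBITRARY periodic cut patterns, and the certificate theorem

`Theorems/LiouvilleSarnakLiouvilleCutRankPeriodicRatio.lean` proved the ratio criterion abstractly in terms of
spreading maps `E_R, E_C` with `N_π(r,c) = E_R(ofBits r) + E_C(ofBits c)`.  This file supplies these maps for an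
ARBITRARY periodic pattern — period `p`, `a` row bits and `a` column bits per period, the `t`-th row (column) bit of
each period at offset `posR t` (`posC t`) — as the explicit sums
`E_X(x) = Σ_{j < x} [bit_j x] · 2^{p ⌊j/a⌋ + posX (j mod a)}`, and proves:

* §1 `sum_testBit_range_eq`, `spread_ofBits`, `spread_step` — range bookkeeping; `E(ofBits r) = Σ_i [r i] 2^{…}`;
  the digit recursion `E(2^a x + d) = 2^p E(x) + pat(d)` (`pat(d) = Σ_{t<a} [bit_t d] 2^{pos t}`).
* §2 `cutNumber_periodic` — for a cut `π` of shape `(p, a, posR, posC)` at any level: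
  `N_π(r, c) = E_R(ofBits r) + E_C(ofBits c)`.
* §3 ★★ `periodicCutRank_of_certificate` — **every periodic cut pattern with an arithmetic certificate has
  unbounded rank**: if `m_R + m_C + 1 = 2^p` (`m_X = Σ_{t<a} 2^{posX t}`; i.e. the row and column offsets
  partition a period) and there are `q ≥ 1` and digits `d_q, d_q' < 2^a` with `pat_C(d_q) = q`, `pat_C(d_q') = q - 1`,
  `λ(m_R + q) ≠ λ(q)`, then `∀ W ∃ n₀ ∀ n ≥ n₀`, every cut of that shape at level `n` has rank `≥ W`.
  (By the census numerics every primitive balanced pattern of period `≤ 14` has such a certificate.)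
* §4 `crrcCutRank` — instance: the palindromic pattern `(CRRC)^m` (`p = 4`, `a = 2`, rows at offsets `1, 2`,
  columns at `0, 3`; `m_R = 6`, certificate `q = 1`: `λ(7) ≠ λ(1)`), a new Class A family.

Honest framing: periodic cut families only; the crux `LiouvilleCutRank` (ALL balanced cuts),
`DigitalBilinearLiouville`, `AlgebraicSarnak` stay OPEN; nothing bears on `VP ≠ VNP`.  No definitions (all maps are
explicit sums).
-/

set_option linter.dupNamespace false

noncomputable section

namespace Summit.ValiantsHypothesis.ValiantsHypothesis.Theorems.LiouvilleSarnakLiouvilleCutRank.PeriodicDigits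

open ArithmeticFunction Finset

open Summit.ValiantsHypothesis.ValiantsHypothesis.Theorems.LiouvilleSarnakLiouvilleCutRank.SignPatterns
  (ofBits_cut_eq_add ofBits_rows_eq_sum ofBits_cols_eq_sum)
open Summit.ValiantsHypothesis.ValiantsHypothesis.Theorems.LiouvilleSarnakLiouvilleCutRank.PeriodicRatio
  (cutRank_of_ratioWitness)

/-! ### §1 Spreading maps as explicit bit sums -/

/-- Bits of `x` vanish from position `x` on, so the bit sum may be taken over any `range N`, `N ≥ x`. [folklore] -/
theorem sum_testBit_range_eq (x N : ℕ) (w : ℕ → ℕ) (hN : x ≤ N) :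
    (∑ j ∈ Finset.range N, (x.testBit j).toNat * w j) = ∑ j ∈ Finset.range x, (x.testBit j).toNat * w j := by
  symm
  apply Finset.sum_subset (Finset.range_subset_range.mpr hN)
  intro j _ hj'
  simp only [Finset.mem_range, not_lt] at hj'
  have hx : x < 2 ^ j := lt_of_lt_of_le Nat.lt_two_pow_self (Nat.pow_le_pow_right (by norm_num) hj')
  rw [Nat.testBit_lt_two_pow hx]
  simp

/-- `E(ofBits r) = Σ_i [r i] · w(i)` for the bit sum `E(x) = Σ_{j<x} [bit_j x] w(j)`. [folklore] -/
theorem spread_ofBits (w : ℕ → ℕ) (n : ℕ) (r : Fin n → Bool) :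
    (∑ j ∈ Finset.range (Nat.ofBits r), ((Nat.ofBits r).testBit j).toNat * w j) =
      ∑ i : Fin n, (r i).toNat * w i := by
  rw [← sum_testBit_range_eq (Nat.ofBits r) (2 ^ n) w (Nat.ofBits_lt_two_pow r).le]
  rw [← Finset.sum_subset (Finset.range_subset_range.mpr (Nat.lt_two_pow_self (n := n)).le)
    (fun j _ hj' => by
      simp only [Finset.mem_range, not_lt] at hj'
      rw [Nat.testBit_ofBits_ge r j hj']
      simp)]
  rw [Finset.sum_range]
  refine Finset.sum_congr rfl fun i _ => ?_
  rw [Nat.testBit_ofBits_lt r i i.2]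

/-- The digit recursion: `E(2^a x + d) = 2^p E(x) + pat(d)` for `d < 2^a`, `0 < a`, where
`E(x) = Σ_{j<x} [bit_j x] 2^{p⌊j/a⌋ + pos(j mod a)}` and `pat(d) = Σ_{t<a} [bit_t d] 2^{pos t}`. [folklore] -/
theorem spread_step (a p : ℕ) (ha : 0 < a) (pos : ℕ → ℕ) (x d : ℕ) (hd : d < 2 ^ a) :
    (∑ j ∈ Finset.range (2 ^ a * x + d),
        ((2 ^ a * x + d).testBit j).toNat * 2 ^ (p * (j / a) + pos (j % a))) =
      2 ^ p * (∑ j ∈ Finset.range x, (x.testBit j).toNat * 2 ^ (p * (j / a) + pos (j % a))) +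
        ∑ t ∈ Finset.range a, (d.testBit t).toNat * 2 ^ pos t := by
  have h2a : 1 ≤ 2 ^ a := Nat.one_le_two_pow
  rw [← sum_testBit_range_eq (2 ^ a * x + d) (a + (2 ^ a * x + d)) _ (by omega), Finset.sum_range_add]
  have hb1 : (∑ j ∈ Finset.range a, ((2 ^ a * x + d).testBit j).toNat * 2 ^ (p * (j / a) + pos (j % a))) =
      ∑ t ∈ Finset.range a, (d.testBit t).toNat * 2 ^ pos t := by
    refine Finset.sum_congr rfl fun j hj => ?_
    rw [Finset.mem_range] at hj
    rw [Nat.testBit_two_pow_mul_add _ hd, if_pos hj, Nat.div_eq_of_lt hj, Nat.mod_eq_of_lt hj, mul_zero,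
      zero_add]
  have hb2 : (∑ j ∈ Finset.range (2 ^ a * x + d),
      ((2 ^ a * x + d).testBit (a + j)).toNat * 2 ^ (p * ((a + j) / a) + pos ((a + j) % a))) =
      2 ^ p * ∑ j ∈ Finset.range (2 ^ a * x + d), (x.testBit j).toNat * 2 ^ (p * (j / a) + pos (j % a)) := by
    rw [Finset.mul_sum]
    refine Finset.sum_congr rfl fun j _ => ?_
    rw [Nat.testBit_two_pow_mul_add _ hd, if_neg (by omega), Nat.add_sub_cancel_left,
      show a + j = j + a by ring, Nat.add_div_right j ha, Nat.add_mod_right,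
      show p * (j / a + 1) + pos (j % a) = (p * (j / a) + pos (j % a)) + p by ring, pow_add]
    ring
  rw [hb1, hb2, sum_testBit_range_eq x _ _ (by nlinarith)]
  ring

/-! ### §2 The cut number of a periodic pattern -/

/-- For a cut `π` of periodic shape — row bit `i` at position `p ⌊i/a⌋ + posR (i mod a)`, column bit `i` at
`p ⌊i/a⌋ + posC (i mod a)` — the cut number splits as `N_π(r, c) = E_R(ofBits r) + E_C(ofBits c)` with the explicit
bit sums. [this file] -/
theorem cutNumber_periodic (a p : ℕ) (posR posC : ℕ → ℕ) (n : ℕ) (π : Fin n ⊕ Fin n ≃ Fin (2 * n))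
    (hπ : ∀ i : Fin n, (π (Sum.inl i) : ℕ) = p * ((i : ℕ) / a) + posR ((i : ℕ) % a) ∧
      (π (Sum.inr i) : ℕ) = p * ((i : ℕ) / a) + posC ((i : ℕ) % a))
    (r c : Fin n → Bool) :
    Nat.ofBits (fun j : Fin (2 * n) => Sum.elim r c (π.symm j)) =
      (∑ j ∈ Finset.range (Nat.ofBits r), ((Nat.ofBits r).testBit j).toNat * 2 ^ (p * (j / a) + posR (j % a))) +
      ∑ j ∈ Finset.range (Nat.ofBits c), ((Nat.ofBits c).testBit j).toNat * 2 ^ (p * (j / a) + posC (j % a)) := by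
  rw [ofBits_cut_eq_add, ofBits_rows_eq_sum, ofBits_cols_eq_sum, spread_ofBits, spread_ofBits]
  congr 1
  · exact Finset.sum_congr rfl fun i _ => by rw [(hπ i).1]
  · exact Finset.sum_congr rfl fun i _ => by rw [(hπ i).2]

/-! ### §3 The certificate theorem -/

/-- `pat(2^a - 1) = Σ_{t<a} 2^{pos t}` (all bits of a full digit are set). [folklore] -/
theorem pat_full (a : ℕ) (pos : ℕ → ℕ) :
    (∑ t ∈ Finset.range a, ((2 ^ a - 1).testBit t).toNat * 2 ^ pos t) = ∑ t ∈ Finset.range a, 2 ^ pos t := by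
  refine Finset.sum_congr rfl fun t ht => ?_
  rw [Finset.mem_range] at ht
  rw [Nat.testBit_two_pow_sub_one, decide_eq_true ht]
  simp

/-- ★★ **Every periodic cut pattern with an arithmetic certificate has unbounded rank.**  Pattern: period `p`,
`a ≥ 1` row and `a` column bits per period at offsets `posR t`, `posC t` (`t < a`), with
`Σ_{t<a} 2^{posR t} + Σ_{t<a} 2^{posC t} + 1 = 2^p` (the offsets partition the period).  Certificate: `q ≥ 1` and
digits `d_q, d_q' < 2^a` with `pat_C(d_q) = q`, `pat_C(d_q') = q - 1` (the bits of `q` and of `q - 1` are column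
offsets) and `λ(m_R + q) ≠ λ(q)`, `m_R = Σ_{t<a} 2^{posR t}`.  Then for every `W` there is `n₀` such that for all
`n ≥ n₀` every cut of this shape at level `n` has cut matrix of rank `≥ W`.  (The row/column roles may be swapped by
transposition.) [this file] -/
theorem periodicCutRank_of_certificate (a p : ℕ) (ha : 0 < a) (posR posC : ℕ → ℕ)
    (hm : (∑ t ∈ Finset.range a, 2 ^ posR t) + (∑ t ∈ Finset.range a, 2 ^ posC t) + 1 = 2 ^ p)
    (q dq dq' : ℕ) (hq : 1 ≤ q) (hdq : dq < 2 ^ a) (hdq' : dq' < 2 ^ a)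
    (hpq : (∑ t ∈ Finset.range a, (dq.testBit t).toNat * 2 ^ posC t) = q)
    (hpq' : (∑ t ∈ Finset.range a, (dq'.testBit t).toNat * 2 ^ posC t) = q - 1)
    (hl : liouville ((∑ t ∈ Finset.range a, 2 ^ posR t) + q) ≠ liouville q) (W : ℕ) :
    ∃ n₀ : ℕ, ∀ n ≥ n₀, ∀ π : Fin n ⊕ Fin n ≃ Fin (2 * n),
      (∀ i : Fin n, (π (Sum.inl i) : ℕ) = p * ((i : ℕ) / a) + posR ((i : ℕ) % a) ∧
        (π (Sum.inr i) : ℕ) = p * ((i : ℕ) / a) + posC ((i : ℕ) % a)) →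
      W ≤ (Matrix.of fun r c : Fin n → Bool =>
        (((liouville (Nat.ofBits (fun k : Fin (2 * n) => Sum.elim r c (π.symm k)) + 1) : ℤ) : ℂ))).rank := by
  obtain ⟨n₀, hn₀⟩ := cutRank_of_ratioWitness
    (fun x => ∑ j ∈ Finset.range x, (x.testBit j).toNat * 2 ^ (p * (j / a) + posR (j % a)))
    (fun y => ∑ j ∈ Finset.range y, (y.testBit j).toNat * 2 ^ (p * (j / a) + posC (j % a)))
    (fun d => ∑ t ∈ Finset.range a, (d.testBit t).toNat * 2 ^ posR t)
    (fun d => ∑ t ∈ Finset.range a, (d.testBit t).toNat * 2 ^ posC t)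
    a p (∑ t ∈ Finset.range a, 2 ^ posR t) (∑ t ∈ Finset.range a, 2 ^ posC t)
    (by simp) (by simp)
    (fun x d hd => spread_step a p ha posR x d hd)
    (fun y d hd => spread_step a p ha posC y d hd)
    (pat_full a posR) (pat_full a posC) hm q dq dq' hq hdq hdq' hpq hpq' hl W
  exact ⟨n₀, fun n hn π hπ => hn₀ n hn π fun r c => cutNumber_periodic a p posR posC n π hπ r c⟩

/-! ### §4 Instance: the palindromic pattern `(CRRC)^m` -/

/-- `λ(7) = -1 ≠ 1 = λ(1)`. [folklore] -/
theorem liouville_seven_ne_one : liouville (6 + 1) ≠ liouville 1 := by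
  rw [show (6 : ℕ) + 1 = 7 by norm_num, liouville_apply_one, liouville_apply (by norm_num : (7 : ℕ) ≠ 0),
    cardFactors_apply_prime (by norm_num : Nat.Prime 7)]
  norm_num

/-- ★ **The `(CRRC)^m` cut family has unbounded rank**: period `4`, row bits at offsets `1, 2`, column bits at
offsets `0, 3`; certificate `q = 1` (`m_R = 6`, `λ(7) ≠ λ(1)`). [this file] -/
theorem crrcCutRank (W : ℕ) : ∃ n₀ : ℕ, ∀ n ≥ n₀, ∀ π : Fin n ⊕ Fin n ≃ Fin (2 * n),
    (∀ i : Fin n, (π (Sum.inl i) : ℕ) = 4 * ((i : ℕ) / 2) + (fun t : ℕ => if t = 0 then 1 else 2) ((i : ℕ) % 2) ∧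
      (π (Sum.inr i) : ℕ) = 4 * ((i : ℕ) / 2) + (fun t : ℕ => if t = 0 then 0 else 3) ((i : ℕ) % 2)) →
      W ≤ (Matrix.of fun r c : Fin n → Bool =>
        (((liouville (Nat.ofBits (fun k : Fin (2 * n) => Sum.elim r c (π.symm k)) + 1) : ℤ) : ℂ))).rank := by
  have hm : (∑ t ∈ Finset.range 2, 2 ^ (fun t : ℕ => if t = 0 then 1 else 2) t) +
      (∑ t ∈ Finset.range 2, 2 ^ (fun t : ℕ => if t = 0 then 0 else 3) t) + 1 = 2 ^ 4 := by decide
  have hpq : (∑ t ∈ Finset.range 2, ((1 : ℕ).testBit t).toNat * 2 ^ (fun t : ℕ => if t = 0 then 0 else 3) t) = 1 := by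
    decide
  have hpq' : (∑ t ∈ Finset.range 2, ((0 : ℕ).testBit t).toNat * 2 ^ (fun t : ℕ => if t = 0 then 0 else 3) t) = 1 - 1 := by
    decide
  have hl : liouville ((∑ t ∈ Finset.range 2, 2 ^ (fun t : ℕ => if t = 0 then 1 else 2) t) + 1) ≠ liouville 1 := by
    rw [show (∑ t ∈ Finset.range 2, 2 ^ (fun t : ℕ => if t = 0 then 1 else 2) t) = 6 by decide]
    exact liouville_seven_ne_one
  exact periodicCutRank_of_certificate 2 4 (by norm_num) (fun t => if t = 0 then 1 else 2)
    (fun t => if t = 0 then 0 else 3) hm 1 1 0 le_rfl (by norm_num) (by norm_num) hpq hpq' hl W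

end Summit.ValiantsHypothesis.ValiantsHypothesis.Theorems.LiouvilleSarnakLiouvilleCutRank.PeriodicDigits

end
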